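import Literature.Computability.Complexity.RossmanMonotoneCliqueSparseNoiseRelative
import Mathlib

/-!
# Route NegLimited — line `sparse-ladder`, stub `stub_sparseRelativePow` (rung F-N1/p3, ROUND-10)

Registered stub of the skeleton `sparse-ladder` on the rung item
`NegLimited.NeglimitedInverseLinearNegations` (stmt-PneNP-19681; HOME/pnp-ideate-p3/r10/sparse-ladder.lean,
sha dee521b8906a2977): the sparse-noise relative Theorem 1 of Rossman
(`Literature.Computability.Complexity.thm1_sparse_relative`, which is stated for a CONSTANT accuracy
`η > 0`) with the POLYNOMIALLY SMALL accuracy `η = n^{-a₀}`, any `0 < a₀ < 1`: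

  for `5 ≤ k'`, `4(c+2) ≤ k' ≤ k`, `0 < ρ`, `0 < δ`, `ρ + δ ≤ 2/k'`, eventually in `n`, every circuit
  `C` over `{∧₂, ∨₂, 0, 1}` on the edges of `Kₙ` with `size C ≤ n ^ c` and every background `x`
  satisfy `Pr_A[C(x ∪ K_A) = 1] ≤ n^{-a₀} + exp(-n^{δ/2}) + Pr_{y ∼ G(n, n^{-ρ})}[C(x ∪ y) = 1]`.

Why the constant-`η` proof already gives this: in the finite dichotomy `thm1_sparse_finite` the first
alternative bounds `Pr_A[C(K_A) = 1]` by the two signature-weight sums, and both are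
`≤ K' · n^{-1}` with `K' = k'(k'²+1)(2B)^{k'²} k^{k'}` (`sum_sigWeight_smallI_le`,
`rpow_mul_sum_sigWeight_medJ_le`) — an explicit RATE `O_k(n^{-1})`, smaller than `n^{-a₀}` eventually
for every `a₀ < 1`.  We therefore prove the rate form of the dichotomy (`sparse_dichotomy_rate`), then
the `η = n^{-a₀}` form of Theorem 1 (`thm1_sparse_pow`), then the restriction step of
`thm1_sparse_relative` verbatim (`Circuit.exists_restrict_sup` at size exponent `c + 1`).

References: B. Rossman, *The monotone complexity of k-clique on random graphs*, FOCS 2010 /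
SIAM J. Comput. 43 (2014), Thm 1 (p. 4), §6 (pp. 8–9), §7 (p. 10) [Rossman2010]; the tree files
`RossmanMonotoneCliqueSparseNoise{,Asymptotic,Relative}.lean`.
-/

set_option linter.dupNamespace false -- `Summit.PneNP.PneNP.…`: summit = sub-problem name (D-0017 single-conjunct layout)

noncomputable section

namespace Summit.PneNP.PneNP.Theorems.NegLimitedSparseLadder

open Finset Filter
open Literature.Computability.Complexity Literature.Combinatorics.SetFamily
open scoped Classical

/-! ### The stub statement (verbatim from the registered skeleton `sparse-ladder`) -/

/-- stub target `SparseRelativePow` (verbatim from HOME/pnp-ideate-p3/r10/sparse-ladder.lean): the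
sparse-noise relative Theorem 1 (`thm1_sparse_relative`) with polynomially small accuracy `η = n^{-a₀}`,
any `0 < a₀ < 1`. -/
def SparseRelativePow : Prop :=
  ∀ (c k k' : ℕ) (ρ δ a₀ : ℝ), 5 ≤ k' → 4 * (c + 2) ≤ k' → k' ≤ k → 0 < ρ → 0 < δ →
    ρ + δ ≤ 2 / (k' : ℝ) → 0 < a₀ → a₀ < 1 →
    ∀ᶠ n : ℕ in atTop, ∀ C : Circuit ↥(⊤ : SimpleGraph (Fin n)).edgeSet,
      C.IsOver monotoneBasis01 → C.size ≤ n ^ c →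
      ∀ x : ↥(⊤ : SimpleGraph (Fin n)).edgeSet → Bool,
        kSubsetProb n k (fun A => C.eval (x ⊔ cliqueVec A) = true) ≤
          (n : ℝ) ^ (-a₀) + Real.exp (-((n : ℝ) ^ (δ / 2))) +
            gnpProb n ((n : ℝ) ^ (-ρ)) (univ.filter fun y => C.eval (x ⊔ y) = true)

/-! ### The sparse-noise dichotomy with its rate -/

/-- **The sparse-noise Theorem 1 as a dichotomy with an explicit rate** (`η`-free form of
`thm1_sparse`): for `5 ≤ k'`, `4(c+1) ≤ k' ≤ k`, `0 < ρ`, `0 < δ`, `ρ + δ ≤ 2/k'`, eventually in `n`,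
every circuit `C` over `{∧₂, ∨₂, 0, 1}` on the edges of `Kₙ` with `size C ≤ n^c` has EITHER
`Pr_A[C(K_A) = 1] ≤ 2 K' n^{-1}` (`K' = k'(k'²+1)(2B)^{k'²} k^{k'}`) OR
`Pr[C(G(n, n^{-ρ})) = 1] ≥ 1 - exp(-n^{δ/2})`.  Proof = the proof of `thm1_sparse` with its
condition `K' n^{-1} < η/2` removed. -/
theorem sparse_dichotomy_rate {c ρ δ : ℝ} {k k' : ℕ} (hk' : 5 ≤ k') (hck' : 4 * (c + 1) ≤ (k' : ℝ))
    (hk'k : k' ≤ k) (hρ : 0 < ρ) (hδ : 0 < δ) (hρδ : ρ + δ ≤ 2 / (k' : ℝ)) :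
    ∀ᶠ n : ℕ in atTop, ∀ C : Circuit ((⊤ : SimpleGraph (Fin n)).edgeSet),
      C.IsOver monotoneBasis01 → (C.size : ℝ) ≤ (n : ℝ) ^ c →
      kSubsetProb n k (fun A => C.eval (cliqueVec A) = true) ≤
          2 * (((k' * (k' ^ 2 + 1) : ℕ) : ℝ) * ((2 * spreadConst) ^ (k' ^ 2) * (k : ℝ) ^ k')) *
            (n : ℝ) ^ (-1 : ℝ) ∨
        1 - Real.exp (-((n : ℝ) ^ (δ / 2))) ≤
          gnpProb n ((n : ℝ) ^ (-ρ)) (univ.filter fun x => C.eval x = true) := by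
  -- adapted from `thm1_sparse` (RossmanMonotoneCliqueSparseNoiseAsymptotic.lean), condition `e5` dropped
  have e1 := eventually_ge_atTop k
  have e2 : ∀ᶠ n : ℕ in atTop, (n : ℝ) ^ (-ρ) < 1 / 2 :=
    ((tendsto_rpow_neg_atTop hρ).comp tendsto_natCast_atTop_atTop).eventually
      (gt_mem_nhds (by norm_num : (0 : ℝ) < 1 / 2))
  have e3 := eventually_exp_neg_rpow_le hδ (by norm_num : (0 : ℝ) < 1 / 2)
  have e4 := eventually_const_le_rpow hδ (Real.log ((k' : ℝ) ^ 2))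
  have e6 := eventually_poly_mul_exp_le (A := (2 : ℝ) ^ (k' ^ 2)) (m := c + k') hδ
    (half_lt_self hδ)
  filter_upwards [e1, e2, e3, e4, e6] with n hkn hp ht hlog hexp C hC hsize
  have hn0 : 0 < n := by omega
  have hn1 : 1 ≤ n := hn0
  have hnr : (0 : ℝ) < n := by exact_mod_cast hn0
  have hk1 : 1 ≤ k := by omega
  have hk'n : k' ≤ n := hk'k.trans hkn
  have hp0 : 0 < (n : ℝ) ^ (-ρ) := Real.rpow_pos_of_pos hnr _
  have hp1 : (n : ℝ) ^ (-ρ) ≤ 1 / 2 := hp.le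
  have ht0 : 0 < tThr δ n := Real.exp_pos _
  have ht1 : tThr δ n ≤ 1 / 2 := ht
  have htp : tThr δ n < 1 - (n : ℝ) ^ (-ρ) := by linarith
  rcases thm1_sparse_finite hk' hk'k hkn hp0 hp1 ht0 ht1 htp C hC with h | h
  · -- the count is small: at most `2 K' n^{-1}`
    left
    have hI := sum_sigWeight_smallI_le (k := k) hn1 hk1 hρδ hlog
    have hJ := rpow_mul_sum_sigWeight_medJ_le (k := k) hn1 hk1 hρδ hck' hlog
    have hSJ0 : 0 ≤ ∑ σ ∈ (medJ n k').image sig, sigWeight n k ((n : ℝ) ^ (-ρ)) (tThr δ n) σ :=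
      sum_nonneg fun σ hσ => by
        obtain ⟨H, hH, rfl⟩ := mem_image.1 hσ
        exact sigWeight_nonneg hp0.le ht0 (by linarith) (medJ_ineq hH).1
    have h1 : (C.size : ℝ) * ∑ σ ∈ (medJ n k').image sig,
        sigWeight n k ((n : ℝ) ^ (-ρ)) (tThr δ n) σ ≤
        (n : ℝ) ^ c * ∑ σ ∈ (medJ n k').image sig,
          sigWeight n k ((n : ℝ) ^ (-ρ)) (tThr δ n) σ :=
      mul_le_mul_of_nonneg_right hsize hSJ0
    have := h.trans (add_le_add hI (h1.trans hJ))
    linarith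
  · -- `C̄ ≡ 1`: the error of Lemma 13 is a stretched exponential
    right
    refine le_trans ?_ h
    have hKcard : (#(smallI n k' ∪ medJ n k') : ℝ) ≤ (n : ℝ) ^ (k' : ℝ) * (2 : ℝ) ^ (k' ^ 2) := by
      have h1 := card_smallI_union_medJ_le (n := n) hk'n
      have h2 : n.choose k' ≤ n ^ k' := Nat.choose_le_pow n k'
      have h3 : 2 ^ k'.choose 2 ≤ 2 ^ (k' ^ 2) := Nat.pow_le_pow_right (by norm_num)
        (by have := two_mul_choose_two_add k'; nlinarith)
      have : #(smallI n k' ∪ medJ n k') ≤ n ^ k' * 2 ^ (k' ^ 2) := h1.trans (Nat.mul_le_mul h2 h3)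
      have : (#(smallI n k' ∪ medJ n k') : ℝ) ≤ ((n ^ k' * 2 ^ (k' ^ 2) : ℕ) : ℝ) := by
        exact_mod_cast this
      rw [Real.rpow_natCast]; push_cast at this; exact this
    have hbound : (C.size : ℝ) * (#(smallI n k' ∪ medJ n k') * tThr δ n) ≤
        (2 : ℝ) ^ (k' ^ 2) * (n : ℝ) ^ (c + k') * Real.exp (-((n : ℝ) ^ δ)) := by
      have : (C.size : ℝ) * (#(smallI n k' ∪ medJ n k') * tThr δ n) ≤
          (n : ℝ) ^ c * ((n : ℝ) ^ (k' : ℝ) * (2 : ℝ) ^ (k' ^ 2) * tThr δ n) :=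
        mul_le_mul hsize (mul_le_mul_of_nonneg_right hKcard ht0.le)
          (mul_nonneg (Nat.cast_nonneg _) ht0.le) (Real.rpow_nonneg hnr.le _)
      refine this.trans (le_of_eq ?_)
      rw [Real.rpow_add hnr, tThr]; ring
    have hε := Real.exp_pos (-((n : ℝ) ^ (δ / 2)))
    linarith

/-! ### Theorem 1 with sparse noise and polynomially small accuracy -/

/-- **The sparse-noise Theorem 1 with `η = n^{-a₀}`** (`0 < a₀ < 1`, size bound in `ℕ`): for
`5 ≤ k'`, `4(c+1) ≤ k' ≤ k`, `0 < ρ`, `0 < δ`, `ρ + δ ≤ 2/k'`, eventually in `n`, every circuit `C`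
over `{∧₂, ∨₂, 0, 1}` with `size C ≤ n ^ c` and `Pr_A[C(K_A) = 1] ≥ n^{-a₀}` satisfies
`Pr[C(G(n, n^{-ρ})) = 1] ≥ 1 - exp(-n^{δ/2})`: the rate `2K' n^{-1}` of `sparse_dichotomy_rate` is
eventually below `n^{-a₀}` (`2K' n^{-(1-a₀)} < 1`). -/
theorem thm1_sparse_pow {c k k' : ℕ} {ρ δ a₀ : ℝ} (hk' : 5 ≤ k') (hck' : 4 * (c + 1) ≤ k')
    (hk'k : k' ≤ k) (hρ : 0 < ρ) (hδ : 0 < δ) (hρδ : ρ + δ ≤ 2 / (k' : ℝ)) (ha₁ : a₀ < 1) :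
    ∀ᶠ n : ℕ in atTop, ∀ C : Circuit ((⊤ : SimpleGraph (Fin n)).edgeSet),
      C.IsOver monotoneBasis01 → C.size ≤ n ^ c →
      (n : ℝ) ^ (-a₀) < kSubsetProb n k (fun A => C.eval (cliqueVec A) = true) →
      1 - Real.exp (-((n : ℝ) ^ (δ / 2))) ≤
        gnpProb n ((n : ℝ) ^ (-ρ)) (univ.filter fun x => C.eval x = true) := by
  have hck'' : 4 * ((c : ℝ) + 1) ≤ (k' : ℝ) := by exact_mod_cast hck'
  set K' : ℝ := 2 * (((k' * (k' ^ 2 + 1) : ℕ) : ℝ) * ((2 * spreadConst) ^ (k' ^ 2) * (k : ℝ) ^ k'))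
    with hK'
  have e5 := eventually_mul_rpow_neg_lt (c := 1 - a₀) (by linarith) one_pos K'
  filter_upwards [sparse_dichotomy_rate (c := (c : ℝ)) (k := k) hk' hck'' hk'k hρ hδ hρδ, e5,
    eventually_gt_atTop 0] with n hn hsmall hn0 C hC hsize hacc
  have hnr : (0 : ℝ) < n := by exact_mod_cast hn0
  have hsizeR : (C.size : ℝ) ≤ (n : ℝ) ^ (c : ℝ) := by
    rw [Real.rpow_natCast]
    exact_mod_cast hsize
  rcases hn C hC hsizeR with h | h
  · -- the small count contradicts `Pr_A ≥ n^{-a₀}`: `2K' n^{-1} = (2K' n^{-(1-a₀)}) · n^{-a₀} < n^{-a₀}`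
    exfalso
    have hna : 0 < (n : ℝ) ^ (-a₀) := Real.rpow_pos_of_pos hnr _
    have hsplit : (n : ℝ) ^ (-1 : ℝ) = (n : ℝ) ^ (-(1 - a₀)) * (n : ℝ) ^ (-a₀) := by
      rw [← Real.rpow_add hnr]
      ring_nf
    have hlt : K' * (n : ℝ) ^ (-1 : ℝ) < (n : ℝ) ^ (-a₀) := by
      rw [hsplit, ← mul_assoc]
      calc K' * (n : ℝ) ^ (-(1 - a₀)) * (n : ℝ) ^ (-a₀) < 1 * (n : ℝ) ^ (-a₀) :=
            mul_lt_mul_of_pos_right hsmall hna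
        _ = (n : ℝ) ^ (-a₀) := one_mul _
    have h' : kSubsetProb n k (fun A => C.eval (cliqueVec A) = true) ≤ K' * (n : ℝ) ^ (-1 : ℝ) := by
      rw [hK']; exact h
    linarith
  · exact h

/-! ### The restriction step -/

/-- One extra gate is absorbed by one extra power: `n ^ c + 1 ≤ n ^ (c + 1)` for `n ≥ 2` (the private
helper of `thm1_sparse_relative`, re-proved). [folklore] -/
theorem pow_add_one_le_pow_succ' {n c : ℕ} (hn2 : 2 ≤ n) : n ^ c + 1 ≤ n ^ (c + 1) := by
  have h1 : 1 ≤ n ^ c := Nat.one_le_pow _ _ (by omega)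
  calc n ^ c + 1 ≤ n ^ c + n ^ c := Nat.add_le_add_left h1 _
    _ = n ^ c * 2 := (Nat.mul_two _).symm
    _ ≤ n ^ c * n := Nat.mul_le_mul_left _ hn2
    _ = n ^ (c + 1) := (Nat.pow_succ _ _).symm

/-- **Stub `stub_sparseRelativePow` of line `sparse-ladder` PROVED** (`SparseRelativePow`, by name): the
sparse-noise relative Theorem 1 with accuracy `n^{-a₀}` — either `Pr_A[C(x ∪ K_A) = 1] ≤ n^{-a₀}`, or
`thm1_sparse_pow` applies to the restriction `C^x` (`Circuit.exists_restrict_sup`, size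
`≤ size C + 1 ≤ n ^ (c+1)` for `n ≥ 2`, class condition `4((c+1)+1) ≤ k'`). -/
theorem stub_sparseRelativePow : SparseRelativePow := by
  intro c k k' ρ δ a₀ hk' hck' hk'k hρ hδ hρδ _ha₀ ha₁
  have hck'' : 4 * (c + 1 + 1) ≤ k' := by omega
  filter_upwards [thm1_sparse_pow (c := c + 1) (k := k) (a₀ := a₀) hk' hck'' hk'k hρ hδ hρδ ha₁,
    eventually_ge_atTop 2] with n hn hn2 C hC hsize x
  have hn1 : (1 : ℝ) ≤ n := by exact_mod_cast (show 1 ≤ n by omega)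
  have hnr : (0 : ℝ) < n := by linarith
  have hexp := Real.exp_pos (-((n : ℝ) ^ (δ / 2)))
  have hna : 0 ≤ (n : ℝ) ^ (-a₀) := Real.rpow_nonneg hnr.le _
  have hp0 : 0 ≤ (n : ℝ) ^ (-ρ) := Real.rpow_nonneg (Nat.cast_nonneg n) _
  have hp1 : (n : ℝ) ^ (-ρ) ≤ 1 := Real.rpow_le_one_of_one_le_of_nonpos hn1 (by linarith)
  have hg0 := gnpProb_nonneg hp0 hp1 (univ.filter fun y => C.eval (x ⊔ y) = true)
  by_cases hacc : (n : ℝ) ^ (-a₀) < kSubsetProb n k (fun A => C.eval (x ⊔ cliqueVec A) = true)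
  · -- the restriction `C^x` is admissible in `thm1_sparse_pow` at exponent `c + 1`
    obtain ⟨C', hC', hsize', heval⟩ := C.exists_restrict_sup hC x
    have hsize'' : C'.size ≤ n ^ (c + 1) :=
      hsize'.trans ((Nat.add_le_add_right hsize 1).trans (pow_add_one_le_pow_succ' hn2))
    have hkA : kSubsetProb n k (fun A => C'.eval (cliqueVec A) = true) =
        kSubsetProb n k (fun A => C.eval (x ⊔ cliqueVec A) = true) :=
      kSubsetProb_congr fun A => by rw [heval]
    have hf : (univ.filter fun y => C'.eval y = true) =
        univ.filter fun y => C.eval (x ⊔ y) = true :=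
      Finset.filter_congr fun y _ => by rw [heval]
    have key := hn C' hC' hsize'' (hacc.trans_eq hkA.symm)
    rw [hf] at key
    have h1 := kSubsetProb_le_one n k (fun A => C.eval (x ⊔ cliqueVec A) = true)
    linarith
  · rw [not_lt] at hacc
    linarith

end Summit.PneNP.PneNP.Theorems.NegLimitedSparseLadder
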